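/-
Copyright (c) 2026 the pub-hodgecm-mathlib formalisation cell (harness21).  Prover seat hodgecm-mathlib-K2E3-p20 (g5), Track B «K2-LIT» ∕ h413
(`stmt-HodgeConjecture-24833`), line `K2_E3_EllipticInputs`, unit U12 §L, kernel road «RICHARDSON» for (L-B_GL) at `N = 3` (road owner K2E3-p11 (g4)),
brick (3-asm): (LBGL-ge3) AT `N = 3` FOLLOWS FROM THE REGULARITY OF THE TWO ORBIT FOURIER TRANSFORMS `Λ̂_E`, `Λ̂_J` — the structure input being ★ p857476.  2026-09-04.
-/
import Summits.HodgeConjecture.HodgeConjecture.Theorems.K2E3GL3NilpotentStructure                    -- ★ p857476 (this seat): `gl3_nilpotentStructure` (J(𝒩)(𝔤𝔩₃) = ℂδ₀ ⊕ ℂΛ_E ⊕ ℂΛ_J)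
import Summits.HodgeConjecture.HodgeConjecture.Theorems.K2E3GL2NilpotentFourierRegularOfStructure      -- ★ p856788 (K2E3-p12 g3): `exists_bound_sqrt_normAbs_discr` (general `N`), pattern of the `N = 2` assembly
import HarnessLib

/-!
# K2_E3 road (h413), §L — (LBGL-ge3) at `N = 3` reduced to the REGULARITY of `Λ̂_E` and `Λ̂_J` (the assembly step; the structure input is ★)

Cell `pub/hodgecm-mathlib` (D-0151), Track B, seat K2E3-p20 (g5); road owner K2E3-p11 (g4), dealer K2E3-plan (g3).  `--supports stmt-HodgeConjecture-24833 --as helper`;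
THEOREMS ONLY (no definition ∕ instance ∕ notation ∕ named fact ∕ `sorry`); never imports `Cruxes/…/Lines`.  COUNT-NEUTRAL ((L-B_GL) ∕ (LBGL-ge3) stay OPEN).

The leaf (LBGL-ge3) `sig_K2E3GLnNilpotentFourierRegularGeThree` (U12 :635) at its one load-bearing instance `N = 3` asks, for every `T ∈ J(𝒩)(𝔤𝔩₃(F))` (clauses
(i)–(iv)), for a locally integrable `F_T` representing `T ∘ 𝓕_ψ`, locally constant on `{disc χ ≠ 0}`, with `|disc χ|^{1∕2}·|F_T|` locally bounded
[HarishChandra1999AdmissibleDistributions, Thm. 4.4].  By ★ p857476 `gl3_nilpotentStructure`, `T = a·δ₀ + b·Λ_E + c·Λ_J` with the Richardson measures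
`Λ_E = (Ad(k)(u−1))_*(κ ⊗ μ_U)` (`U` = unipotent radical of the `(2,1)` parabolic) and `Λ_J = (Ad(k)(u−1))_*(κ ⊗ μ_N)` (`N₃` upper unitriangular).  This file is the
𝔤𝔩₃ twin of ★ p856788 `gl2_nilpotentFourierRegular_of_structure` WITH THE STRUCTURE HYPOTHESIS DISCHARGED:
* §1 `fourierRegular_of_eq_delta_add_two` (any `N`, abstract functionals `M₁`, `M₂`): `T = a·δ₀ + b·M₁ + c·M₂` on `C_c^∞` and `M_i ∘ 𝓕 = F_i` regular ⟹ `F_T := a + b·F₁ + c·F₂`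
  has the four properties (`𝓕f(0) = ∫ f`, ★ `matrixFourier_apply_zero`; `𝓕f ∈ C_c^∞`, ★ `isLocSmooth_matrixFourier`; `|disc|^{1∕2}` bounded on compacta, ★ `exists_bound_sqrt_normAbs_discr`).
* §2 **`gl3_nilpotentFourierRegular_of_orbitFourier`**: IF `Λ̂_E` and `Λ̂_J` are represented by locally integrable functions `F_E`, `F_J`, locally constant on the regular
  semisimple set with `|disc χ|^{1∕2}·|F|` locally bounded (hypotheses `hBE`, `hBJ`, in the socket's currency, the orbital side in Rao's `K × U` form), THEN the body
  of (LBGL-ge3) holds at `N = 3` for every `T`, with `F_T = a + b·F_E + c·F_J`.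
So (LBGL-ge3)|_{N=3} ⟸ {(LBGL-3b-E) regularity of `Λ̂_E`, (LBGL-3b-J) regularity of `Λ̂_J`} — two analytic leaves (van Dijk ∕ Harish-Chandra: `F_J = c·𝟙_{split}·|disc χ|^{-1∕2}`
through the Fourier bridge `Λ_J(𝓕f) = c∫_K∫_𝔟 f(Ad(k)b)` (★ `integral_matrixFourier_subspace_eq`) and the split-Cartan slice density of `𝔤𝔩₃` ((S-B♭)_Lie, K2E3-p17 (g6) D60);
`F_E` through ★ R3 `integral_matrixFourier_nilBlock_eq` and the `𝔭₍₂,₁₎`-slice density).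
[HarishChandra1999AdmissibleDistributions, §3 Thm. 3.9, Cor. 3.10 p. 10; §4 Thm. 4.4 p. 11]; [Howe1974, Prop. 3].

HONEST LABEL: HC_CM is proved only modulo the 7 printed citations (2 remaining named inputs: hLiu418 = stmt-HodgeConjecture-24832, h413 = stmt-HodgeConjecture-24833)
until rung 0 closes; count-neutral helper.
-/

set_option autoImplicit false
set_option linter.dupNamespace false   -- `Summit.HodgeConjecture.HodgeConjecture.…` (D-0017 nested layout; lakefile exemption for Summits)

noncomputable section

open MeasureTheory Measure Filter Topology
open scoped MatrixGroups NNReal ENNReal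
open Literature.NumberTheory.Rogawski1990 Literature.NumberTheory.Automorphic Literature.NumberTheory.Automorphic.LocalFieldHaar
open Literature.NumberTheory.GaloisRepresentations Literature.NumberTheory.GaloisRepresentations.IsNonarchimedeanLocalField
open Summit.HodgeConjecture.HodgeConjecture.Cruxes.H413.K2E3GLnNilpotentFourierPointSupport
open Summit.HodgeConjecture.HodgeConjecture.Cruxes.H413.K2E3GL2NilpotentFourierRegularOfStructure
open Summit.HodgeConjecture.HodgeConjecture.Cruxes.H413.K2E3GL3NilpotentStructure

namespace Summit.HodgeConjecture.HodgeConjecture.Cruxes.H413.K2E3GL3NilpotentFourierRegularOfOrbitFourier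

variable {F : Type*} [Field F] [ValuativeRel F] [TopologicalSpace F] [IsNonarchimedeanLocalField F]

/-! ## §1  `T = a·δ₀ + b·M₁ + c·M₂` and `M̂ᵢ = Fᵢ` give `T̂ = a + b·F₁ + c·F₂` (any `N`, abstract `M₁`, `M₂`) -/

section Assembly

variable {N : ℕ} (ψ : AddChar F Circle) [MeasurableSpace (Matrix (Fin N) (Fin N) F)] [BorelSpace (Matrix (Fin N) (Fin N) F)]
  (μ𝔤 : Measure (Matrix (Fin N) (Fin N) F)) [μ𝔤.IsAddHaarMeasure]

/-- **Assembly for one `T` and two orbital functionals** (any `N`): if `T f = a·f(0) + b·M₁ f + c·M₂ f` on `C_c^∞(𝔤𝔩_N(F))` and `F₁`, `F₂` are locally integrable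
functions representing `M₁ ∘ 𝓕`, `M₂ ∘ 𝓕`, locally constant on `{disc χ ≠ 0}` with `|disc χ|^{1∕2}·|Fᵢ|` locally bounded, then `F_T := a + b·F₁ + c·F₂` has the four
properties (L-B_GL) asks of `T`. [cite: HarishChandra1999AdmissibleDistributions, Thm. 4.4 p. 11, Cor. 3.10 p. 10] -/
theorem fourierRegular_of_eq_delta_add_two (hψ : ψ.IsContinuousNontrivial) (T M₁ M₂ : (Matrix (Fin N) (Fin N) F → ℂ) → ℂ) (a b c : ℂ)
    (habc : ∀ f : Matrix (Fin N) (Fin N) F → ℂ, IsLocSmooth f → T f = a * f 0 + b * M₁ f + c * M₂ f)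
    (F₁ F₂ : Matrix (Fin N) (Fin N) F → ℂ) (h₁_int : LocallyIntegrable F₁ μ𝔤) (h₂_int : LocallyIntegrable F₂ μ𝔤)
    (h₁_rep : ∀ f : Matrix (Fin N) (Fin N) F → ℂ, IsLocSmooth f →
      M₁ (fun Y : Matrix (Fin N) (Fin N) F => ∫ X, ((ψ (Matrix.trace (Y * X)) : Circle) : ℂ) * f X ∂μ𝔤) = ∫ X, f X * F₁ X ∂μ𝔤)
    (h₂_rep : ∀ f : Matrix (Fin N) (Fin N) F → ℂ, IsLocSmooth f →
      M₂ (fun Y : Matrix (Fin N) (Fin N) F => ∫ X, ((ψ (Matrix.trace (Y * X)) : Circle) : ℂ) * f X ∂μ𝔤) = ∫ X, f X * F₂ X ∂μ𝔤)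
    (h₁_lc : ∀ X : Matrix (Fin N) (Fin N) F, IsUnit X.charpoly.discr → ∀ᶠ Y in 𝓝 X, F₁ Y = F₁ X)
    (h₂_lc : ∀ X : Matrix (Fin N) (Fin N) F, IsUnit X.charpoly.discr → ∀ᶠ Y in 𝓝 X, F₂ Y = F₂ X)
    (h₁_bd : ∀ C : Set (Matrix (Fin N) (Fin N) F), IsCompact C → ∃ B : ℝ, ∀ X ∈ C, ((NNReal.sqrt (normAbs F X.charpoly.discr) : ℝ≥0) : ℝ) * ‖F₁ X‖ ≤ B)
    (h₂_bd : ∀ C : Set (Matrix (Fin N) (Fin N) F), IsCompact C → ∃ B : ℝ, ∀ X ∈ C, ((NNReal.sqrt (normAbs F X.charpoly.discr) : ℝ≥0) : ℝ) * ‖F₂ X‖ ≤ B) :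
    LocallyIntegrable (fun X => a + b * F₁ X + c * F₂ X) μ𝔤 ∧
      (∀ f : Matrix (Fin N) (Fin N) F → ℂ, IsLocSmooth f →
          T (fun Y => ∫ X, ((ψ (Matrix.trace (Y * X)) : Circle) : ℂ) * f X ∂μ𝔤) = ∫ X, f X * (a + b * F₁ X + c * F₂ X) ∂μ𝔤) ∧
      (∀ X : Matrix (Fin N) (Fin N) F, IsUnit X.charpoly.discr → ∀ᶠ Y in 𝓝 X, a + b * F₁ Y + c * F₂ Y = a + b * F₁ X + c * F₂ X) ∧
      (∀ C : Set (Matrix (Fin N) (Fin N) F), IsCompact C → ∃ B : ℝ, ∀ X ∈ C,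
          ((NNReal.sqrt (normAbs F X.charpoly.discr) : ℝ≥0) : ℝ) * ‖a + b * F₁ X + c * F₂ X‖ ≤ B) := by
  haveI : T2Space F := (isLocalField F).toT2Space
  haveI : LocallyCompactSpace F := (isLocalField F).toLocallyCompactSpace
  haveI : LocallyCompactSpace (Matrix (Fin N) (Fin N) F) := Pi.locallyCompactSpace_of_finite
  refine ⟨?_, ?_, ?_, ?_⟩
  · -- local integrability
    have h0 : LocallyIntegrable (fun _ : Matrix (Fin N) (Fin N) F => a) μ𝔤 := locallyIntegrable_const a
    have h1 : LocallyIntegrable (fun X : Matrix (Fin N) (Fin N) F => b * F₁ X) μ𝔤 := by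
      simpa only [Pi.smul_def, smul_eq_mul] using h₁_int.smul b
    have h2 : LocallyIntegrable (fun X : Matrix (Fin N) (Fin N) F => c * F₂ X) μ𝔤 := by
      simpa only [Pi.smul_def, smul_eq_mul] using h₂_int.smul c
    exact (h0.add h1).add h2
  · -- the representation `T(𝓕f) = ∫ f·(a + b F₁ + c F₂)`
    intro f hf
    have hFf : IsLocSmooth fun Y : Matrix (Fin N) (Fin N) F => ∫ X, ((ψ (Matrix.trace (Y * X)) : Circle) : ℂ) * f X ∂μ𝔤 :=
      isLocSmooth_matrixFourier hψ μ𝔤 hf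
    rw [habc _ hFf, matrixFourier_apply_zero ψ μ𝔤 f, h₁_rep f hf, h₂_rep f hf]
    have hfi : Integrable f μ𝔤 := hf.continuous.integrable_of_hasCompactSupport hf.2
    have hf₁ : Integrable (fun X => f X * F₁ X) μ𝔤 := by
      simpa only [smul_eq_mul] using h₁_int.integrable_smul_left_of_hasCompactSupport hf.continuous hf.2
    have hf₂ : Integrable (fun X => f X * F₂ X) μ𝔤 := by
      simpa only [smul_eq_mul] using h₂_int.integrable_smul_left_of_hasCompactSupport hf.continuous hf.2
    have hsplit : (fun X => f X * (a + b * F₁ X + c * F₂ X)) = fun X => a * f X + b * (f X * F₁ X) + c * (f X * F₂ X) := by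
      funext X; ring
    have h12 : Integrable (fun X => a * f X + b * (f X * F₁ X)) μ𝔤 := (hfi.const_mul a).add (hf₁.const_mul b)
    rw [hsplit, integral_add h12 (hf₂.const_mul c), integral_add (hfi.const_mul a) (hf₁.const_mul b),
      integral_const_mul, integral_const_mul, integral_const_mul]
  · -- local constancy on the regular semisimple set
    intro X hX
    filter_upwards [h₁_lc X hX, h₂_lc X hX] with Y hY₁ hY₂
    rw [hY₁, hY₂]
  · -- `|disc|^{1/2}·|a + b F₁ + c F₂|` is locally bounded
    intro C hC
    obtain ⟨M, -, hM⟩ := exists_bound_sqrt_normAbs_discr (F := F) hC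
    obtain ⟨B₁, hB₁⟩ := h₁_bd C hC
    obtain ⟨B₂, hB₂⟩ := h₂_bd C hC
    refine ⟨M * ‖a‖ + ‖b‖ * B₁ + ‖c‖ * B₂, fun X hX => ?_⟩
    have hD0 : 0 ≤ ((NNReal.sqrt (normAbs F X.charpoly.discr) : ℝ≥0) : ℝ) := NNReal.coe_nonneg _
    calc ((NNReal.sqrt (normAbs F X.charpoly.discr) : ℝ≥0) : ℝ) * ‖a + b * F₁ X + c * F₂ X‖
        ≤ ((NNReal.sqrt (normAbs F X.charpoly.discr) : ℝ≥0) : ℝ) * (‖a‖ + ‖b‖ * ‖F₁ X‖ + ‖c‖ * ‖F₂ X‖) := by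
          refine mul_le_mul_of_nonneg_left ?_ hD0
          calc ‖a + b * F₁ X + c * F₂ X‖ ≤ ‖a + b * F₁ X‖ + ‖c * F₂ X‖ := norm_add_le _ _
            _ ≤ ‖a‖ + ‖b * F₁ X‖ + ‖c * F₂ X‖ := add_le_add (norm_add_le _ _) le_rfl
            _ = ‖a‖ + ‖b‖ * ‖F₁ X‖ + ‖c‖ * ‖F₂ X‖ := by rw [norm_mul, norm_mul]
      _ = ((NNReal.sqrt (normAbs F X.charpoly.discr) : ℝ≥0) : ℝ) * ‖a‖ +
            ‖b‖ * (((NNReal.sqrt (normAbs F X.charpoly.discr) : ℝ≥0) : ℝ) * ‖F₁ X‖) +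
            ‖c‖ * (((NNReal.sqrt (normAbs F X.charpoly.discr) : ℝ≥0) : ℝ) * ‖F₂ X‖) := by ring
      _ ≤ M * ‖a‖ + ‖b‖ * B₁ + ‖c‖ * B₂ :=
          add_le_add (add_le_add (mul_le_mul_of_nonneg_right (hM X hX) (norm_nonneg _)) (mul_le_mul_of_nonneg_left (hB₁ X hX) (norm_nonneg _)))
            (mul_le_mul_of_nonneg_left (hB₂ X hX) (norm_nonneg _))

end Assembly

/-! ## §2  (LBGL-ge3) at `N = 3` from the regularity of `Λ̂_E` and `Λ̂_J` -/

section Three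

variable (ψ : AddChar F Circle) [MeasurableSpace (Matrix (Fin 3) (Fin 3) F)] [BorelSpace (Matrix (Fin 3) (Fin 3) F)]
  (μ𝔤 : Measure (Matrix (Fin 3) (Fin 3) F)) [μ𝔤.IsAddHaarMeasure]
  [MeasurableSpace F] [BorelSpace F] [MeasurableSpace (GL (Fin 3) F)] [BorelSpace (GL (Fin 3) F)]
  (κ : Measure ↥(glInt 3 F)) [IsHaarMeasure κ] (μU : Measure ↥(unipotentRadicalGL F ![false, false, true])) [IsHaarMeasure μU]
  (μN : Measure ↥(unipotentRadicalGL F (id : Fin 3 → Fin 3))) [IsHaarMeasure μN]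

/-- **(LBGL-ge3) AT `N = 3` FROM THE REGULARITY OF THE TWO ORBIT FOURIER TRANSFORMS.**  `F` non-archimedean local, `ψ` continuous non-trivial, `μ𝔤` a Haar measure on
`𝔤𝔩₃(F)`, `κ`, `μ_U`, `μ_N` Haar on `GL₃(𝒪)`, `U₍₂,₁₎`, `N₃`.  IF the Fourier transforms of the two Richardson measures — `f ↦ ∫_{K×U} 𝓕f(Ad(k)(u−1))` and
`f ↦ ∫_{K×N₃} 𝓕f(Ad(k)(u−1))` — are represented by locally integrable `F_E`, `F_J`, locally constant on `{disc χ ≠ 0}` with `|disc χ|^{1∕2}·|F|` locally bounded, THEN for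
every `T` with the four `J(𝒩)` clauses the conclusion of `sig_K2E3GLnNilpotentFourierRegularGeThree` holds at `N = 3` (with `F_T = a + b·F_E + c·F_J`, the structure
`T = a·δ₀ + b·Λ_E + c·Λ_J` being ★ p857476 `gl3_nilpotentStructure`). [cite: HarishChandra1999AdmissibleDistributions, Thm. 4.4 p. 11, Thm. 3.9, Cor. 3.10 p. 10]
[cite: Howe1974, Prop. 3] -/
theorem gl3_nilpotentFourierRegular_of_orbitFourier (hψ : ψ.IsContinuousNontrivial)
    (hBE : ∃ Fr : Matrix (Fin 3) (Fin 3) F → ℂ, LocallyIntegrable Fr μ𝔤 ∧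
      (∀ f : Matrix (Fin 3) (Fin 3) F → ℂ, IsLocSmooth f →
        ∫ q : ↥(glInt 3 F) × ↥(unipotentRadicalGL F ![false, false, true]),
            (fun Y : Matrix (Fin 3) (Fin 3) F => ∫ X, ((ψ (Matrix.trace (Y * X)) : Circle) : ℂ) * f X ∂μ𝔤)
              ((((q.1 : GL (Fin 3) F)) : Matrix (Fin 3) (Fin 3) F) * ((((q.2 : GL (Fin 3) F)) : Matrix (Fin 3) (Fin 3) F) - 1) *
                ((((q.1 : GL (Fin 3) F))⁻¹ : GL (Fin 3) F) : Matrix (Fin 3) (Fin 3) F)) ∂(κ.prod μU) = ∫ X, f X * Fr X ∂μ𝔤) ∧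
      (∀ X : Matrix (Fin 3) (Fin 3) F, IsUnit X.charpoly.discr → ∀ᶠ Y in 𝓝 X, Fr Y = Fr X) ∧
      (∀ C : Set (Matrix (Fin 3) (Fin 3) F), IsCompact C → ∃ B : ℝ, ∀ X ∈ C, ((NNReal.sqrt (normAbs F X.charpoly.discr) : ℝ≥0) : ℝ) * ‖Fr X‖ ≤ B))
    (hBJ : ∃ Fr : Matrix (Fin 3) (Fin 3) F → ℂ, LocallyIntegrable Fr μ𝔤 ∧
      (∀ f : Matrix (Fin 3) (Fin 3) F → ℂ, IsLocSmooth f →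
        ∫ q : ↥(glInt 3 F) × ↥(unipotentRadicalGL F (id : Fin 3 → Fin 3)),
            (fun Y : Matrix (Fin 3) (Fin 3) F => ∫ X, ((ψ (Matrix.trace (Y * X)) : Circle) : ℂ) * f X ∂μ𝔤)
              (((q.1 : GL (Fin 3) F) : Matrix (Fin 3) (Fin 3) F) * (((q.2 : GL (Fin 3) F) : Matrix (Fin 3) (Fin 3) F) - 1) *
                (((q.1 : GL (Fin 3) F)⁻¹ : GL (Fin 3) F) : Matrix (Fin 3) (Fin 3) F)) ∂(κ.prod μN) = ∫ X, f X * Fr X ∂μ𝔤) ∧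
      (∀ X : Matrix (Fin 3) (Fin 3) F, IsUnit X.charpoly.discr → ∀ᶠ Y in 𝓝 X, Fr Y = Fr X) ∧
      (∀ C : Set (Matrix (Fin 3) (Fin 3) F), IsCompact C → ∃ B : ℝ, ∀ X ∈ C, ((NNReal.sqrt (normAbs F X.charpoly.discr) : ℝ≥0) : ℝ) * ‖Fr X‖ ≤ B))
    (T : (Matrix (Fin 3) (Fin 3) F → ℂ) → ℂ)
    (hT : (∀ f₁ f₂ : Matrix (Fin 3) (Fin 3) F → ℂ, IsLocSmooth f₁ → IsLocSmooth f₂ → T (f₁ + f₂) = T f₁ + T f₂) ∧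
       (∀ (a : ℂ) (f : Matrix (Fin 3) (Fin 3) F → ℂ), IsLocSmooth f → T (a • f) = a * T f) ∧
       (∀ (x : GL (Fin 3) F) (f : Matrix (Fin 3) (Fin 3) F → ℂ), IsLocSmooth f →
          T (fun X => f ((x : Matrix (Fin 3) (Fin 3) F) * X * ((x⁻¹ : GL (Fin 3) F) : Matrix (Fin 3) (Fin 3) F))) = T f) ∧
       (∀ f : Matrix (Fin 3) (Fin 3) F → ℂ, IsLocSmooth f → (∀ X ∈ tsupport f, ¬ IsNilpotent X) → T f = 0)) :
    ∃ Fn : Matrix (Fin 3) (Fin 3) F → ℂ, LocallyIntegrable Fn μ𝔤 ∧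
      (∀ f : Matrix (Fin 3) (Fin 3) F → ℂ, IsLocSmooth f →
          T (fun Y => ∫ X, ((ψ (Matrix.trace (Y * X)) : Circle) : ℂ) * f X ∂μ𝔤) = ∫ X, f X * Fn X ∂μ𝔤) ∧
      (∀ X : Matrix (Fin 3) (Fin 3) F, IsUnit X.charpoly.discr → ∀ᶠ Y in 𝓝 X, Fn Y = Fn X) ∧
      (∀ C : Set (Matrix (Fin 3) (Fin 3) F), IsCompact C → ∃ B : ℝ, ∀ X ∈ C,
          ((NNReal.sqrt (normAbs F X.charpoly.discr) : ℝ≥0) : ℝ) * ‖Fn X‖ ≤ B) := by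
  obtain ⟨a, b, c, habc⟩ := gl3_nilpotentStructure κ μU μN T hT
  obtain ⟨F₁, h₁_int, h₁_rep, h₁_lc, h₁_bd⟩ := hBE
  obtain ⟨F₂, h₂_int, h₂_rep, h₂_lc, h₂_bd⟩ := hBJ
  exact ⟨fun X => a + b * F₁ X + c * F₂ X,
    fourierRegular_of_eq_delta_add_two ψ μ𝔤 hψ T
      (fun g => ∫ q : ↥(glInt 3 F) × ↥(unipotentRadicalGL F ![false, false, true]), g ((((q.1 : GL (Fin 3) F)) : Matrix (Fin 3) (Fin 3) F) *
        ((((q.2 : GL (Fin 3) F)) : Matrix (Fin 3) (Fin 3) F) - 1) * ((((q.1 : GL (Fin 3) F))⁻¹ : GL (Fin 3) F) : Matrix (Fin 3) (Fin 3) F)) ∂(κ.prod μU))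
      (fun g => ∫ q : ↥(glInt 3 F) × ↥(unipotentRadicalGL F (id : Fin 3 → Fin 3)), g (((q.1 : GL (Fin 3) F) : Matrix (Fin 3) (Fin 3) F) *
        (((q.2 : GL (Fin 3) F) : Matrix (Fin 3) (Fin 3) F) - 1) * (((q.1 : GL (Fin 3) F)⁻¹ : GL (Fin 3) F) : Matrix (Fin 3) (Fin 3) F)) ∂(κ.prod μN))
      a b c habc F₁ F₂ h₁_int h₂_int h₁_rep h₂_rep h₁_lc h₂_lc h₁_bd h₂_bd⟩

end Three

end Summit.HodgeConjecture.HodgeConjecture.Cruxes.H413.K2E3GL3NilpotentFourierRegularOfOrbitFourier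

end
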